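import Literature.NumberTheory.Rogawski1990.ArchStableSumGProduct              -- ★ (12′) FILE P p852033: `sum_partnerPerms_eq_sum_sum_restrict`, `mem_partnerPerms_iff_restrict`, `restrict_piEquivPiSubtypeProd_symm_fst∕snd`
import Literature.NumberTheory.Rogawski1990.ArchInnerTwistChartDictionary       -- ★ (3) p851905: `formSign_eq_of_not_mem_splitChartPlaces`
import Literature.NumberTheory.Automorphic.ArchInnerFormChartOrbWeyl            -- ★ (LH3-p02) ED. 3: `chartOrbG_swap` (same-sign compact swaps are realised in `G′_w`)
import HarnessLib

/-!
# EP ASSEMBLY, DEFINITE PLACES I: at an `α`-DEFINITE place every slot permutation is realised in `G′_w ≅ U(3)`, so `chartOrbG` is slot-invariant there and the partner sum over the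
# definite block collapses to `6^{#D}` equal terms (N8-INNER ROAD B, brick (12′) E2a; Shelstad 1979 §4 Lemma 4.2; Rogawski 1990 §3.6, §4.1 (4.1.1), §8.2)

Topic `NumberTheory/Rogawski1990`; namespace `Literature.NumberTheory.Rogawski1990`.  THEOREMS ONLY (no `def`, no instance, no notation, no axiom, no named fact, no `sorry`).  Cell
`pub/hodgecm-mathlib`, crux H413 (`stmt-HodgeConjecture-24833`), F0∕P3c road «N8-INNER» ROAD B (LH2-plan (g1) 16:08:52Z∕16:17:17Z GO), brick (12′) «EP ASSEMBLY» FILE E2a (census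
`F0/P3c/LH7/LH7-p01/g7/ep/CENSUS-N8-brick12EP.v1.LH7p01g7.md` 4b6e6521d5d67659 §4 «`α`-side: `Σ_{σ∈S₃}` of SIX EQUAL `U(3)`-terms per definite place»; holder LH7-p01 (g7)).  Count-neutral.

THE MATHEMATICS.  House frame `α` (`α_i ≠ 0`, `c(α_i) = α_i`), an admissible label `S′` (`S′ ⊆ splitChartPlaces L α`), the block `p` of places with `p w → w ∉ splitChartPlaces L α` (the
`α`-DEFINITE places `D`; automatically `w ∉ S′`).  At such a `w` the three signs of the place form coincide (★ `formSign_eq_of_not_mem_splitChartPlaces`), so EVERY transposition of the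
slots is a same-sign compact swap, realised by an involution of `G′_w = U(3)` (★ `chartOrbG_swap`); hence:
* §1 **`chartOrbG_update_comp_perm_of_not_mem_splitChartPlaces`**: `chartOrbG ν′ S′ a′ (update c w (c w ∘ σ)) = chartOrbG ν′ S′ a′ c` for EVERY `σ ∈ S₃` (swap induction);
* §2 **`chartOrbG_slotPerm_eq_of_forall_not_eq`**: two relabellings agreeing off the block `p` give the same `chartOrbG` (place-by-place induction over the block);
* §3 **`sum_partnerPerms_chartOrbG_eq_card_mul_sum_restrict`**: `Σ_{ρ ∈ partnerPerms S′} chartOrbG … (ρ·c) = 6^{#p} · Σ_{ρ₂ ∈ partnerPerms S′|_{¬p}} chartOrbG … ((1 ⊔ ρ₂)·c)` (★ FILE P (P1);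
  the `p`-block of `partnerPerms S′` is all of `S₃^{p}`, `|S₃| = 6`) — the `6^{#D}` of the census's constant `6κ_w = 2`.
HONEST LABEL: HC_CM is proved only modulo the 7 printed citations (2 remaining: hLiu418 = `stmt-HodgeConjecture-24832`, h413 = `stmt-HodgeConjecture-24833`) until rung 0 closes; count-neutral
until the junction payer is ★ and ED. 43 re-keys 27456 6 → 5.

## References
* [Shelstad1979] D. Shelstad, *Characters and inner forms of a quasi-split group over ℝ*, Compositio Math. 39 (1979), §4 pp. 22–24, Lemma 4.2 p. 23.
* [Rogawski1990] J. D. Rogawski, *Automorphic Representations of Unitary Groups in Three Variables*, Ann. of Math. Stud. 123 (1990), §3.6 p. 28 (`U(3)`: all Cartans conjugate, Weyl group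
  `S₃` realised), §4.1 (4.1.1) p. 39, §8.2 p. 122.
* [Knapp1986] A. W. Knapp, *Representation Theory of Semisimple Groups* (1986), Ch. V §3.
-/

set_option autoImplicit false

noncomputable section

open MeasureTheory MeasureTheory.Measure NumberField NumberField.InfinitePlace Matrix Complex Topology
open Literature.NumberTheory.Automorphic Literature.NumberTheory.Automorphic.UnitaryGroup Literature.NumberTheory.Automorphic.ArchCartan
open scoped MatrixGroups Matrix Classical

namespace Literature.NumberTheory.Rogawski1990

section Definite

variable (L : Type) [Field L] [NumberField L] [IsCMField L] (α : Fin 3 → L)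
  [MeasurableSpace ↥(arch (↥(maximalRealSubfield L)) L (IsCMField.complexConj L) 3 (Matrix.diagonal α))] [BorelSpace ↥(arch (↥(maximalRealSubfield L)) L (IsCMField.complexConj L) 3 (Matrix.diagonal α))]
  (ν' : Measure ↥(arch (↥(maximalRealSubfield L)) L (IsCMField.complexConj L) 3 (Matrix.diagonal α))) [ν'.IsHaarMeasure] [ν'.IsMulRightInvariant]
  (S' : Finset {w : InfinitePlace L // IsComplex w})

/-! ## §1 At a definite place every slot permutation leaves `chartOrbG` unchanged -/

/-- **SLOT INVARIANCE OF `chartOrbG` AT AN `α`-DEFINITE PLACE**: for `w ∉ splitChartPlaces L α` (hence `w ∉ S′`) and EVERY `σ ∈ S₃`, relabelling the three angle slots at `w` by `σ` does not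
change `chartOrbG ν′ S′ a′` (every transposition is a same-sign swap there, ★ `formSign_eq_of_not_mem_splitChartPlaces`, realised by an involution of `G′_w = U(3)`, ★ `chartOrbG_swap`; swap induction).
[cite: Rogawski1990, §3.6 p. 28; §8.2 p. 122] [cite: Shelstad1979, §4 p. 23] [cite: Knapp1986, Ch. V §3] -/
theorem chartOrbG_update_comp_perm_of_not_mem_splitChartPlaces (hα : ∀ i, α i ≠ 0) (hherm : ∀ i, (IsCMField.complexConj L (α i) : L) = α i)
    (hS' : ∀ w, w ∈ S' → w ∈ splitChartPlaces L α) {w : {w : InfinitePlace L // IsComplex w}} (hsp : w ∉ splitChartPlaces L α)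
    (a' : ↥(arch (↥(maximalRealSubfield L)) L (IsCMField.complexConj L) 3 (Matrix.diagonal α)) → ℂ) (σ : Equiv.Perm (Fin 3))
    (c : {w : InfinitePlace L // IsComplex w} → Fin 3 → ℝ) :
    chartOrbG L α ν' S' a' (Function.update c w (c w ∘ σ)) = chartOrbG L α ν' S' a' c := by
  have hreal : ∀ k, (w.1.embedding (α k)).im = 0 := fun k => im_embedding_diagonal_eq_zero L 3 α hherm w k
  have hw : w ∉ S' := fun h => hsp (hS' w h)
  have hsign : ∀ i j : Fin 3, formSign L α w (lineOf (formSign L α w) i) = formSign L α w (lineOf (formSign L α w) j) := by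
    obtain ⟨h01, h12⟩ := formSign_eq_of_not_mem_splitChartPlaces L hα hreal hsp
    have hall : ∀ k : Fin 3, formSign L α w k = formSign L α w 0 := by
      intro k
      fin_cases k
      · rfl
      · exact h01.symm
      · exact (h01.trans h12).symm
    intro i j
    rw [hall (lineOf (formSign L α w) i), hall (lineOf (formSign L α w) j)]
  induction σ using Equiv.Perm.swap_induction_on generalizing c with
  | one =>
      have h : c w ∘ ⇑(1 : Equiv.Perm (Fin 3)) = c w := rfl
      rw [h, Function.update_eq_self]
  | swap_mul τ i j _ ih =>
      have hcomp : Function.update c w (c w ∘ ⇑(Equiv.swap i j * τ)) =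
          Function.update (Function.update c w (c w ∘ ⇑(Equiv.swap i j))) w ((Function.update c w (c w ∘ ⇑(Equiv.swap i j))) w ∘ ⇑τ) := by
        rw [Function.update_self, Function.update_idem]
        rfl
      rw [hcomp, ih, chartOrbG_swap L α ν' S' hα hS' hreal hw i j (hsign i j) a' c]

/-! ## §2 Relabellings agreeing off the definite block give the same `chartOrbG` -/

variable (p : {w : InfinitePlace L // IsComplex w} → Prop) [DecidablePred p]

/-- **Two relabellings that agree OFF the block `p` (of `α`-definite places) read the same `chartOrbG`** (induction over the block, §1 at each place with `σ := (ρ w)⁻¹ ρ′ w`).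
[cite: Rogawski1990, §3.6 p. 28; §4.1 (4.1.1) p. 39] [cite: Shelstad1979, Lemma 4.2 p. 23] -/
theorem chartOrbG_slotPerm_eq_of_forall_not_eq (hα : ∀ i, α i ≠ 0) (hherm : ∀ i, (IsCMField.complexConj L (α i) : L) = α i)
    (hS' : ∀ w, w ∈ S' → w ∈ splitChartPlaces L α) (hp : ∀ w, p w → w ∉ splitChartPlaces L α)
    (a' : ↥(arch (↥(maximalRealSubfield L)) L (IsCMField.complexConj L) 3 (Matrix.diagonal α)) → ℂ)
    {ρ ρ' : {w : InfinitePlace L // IsComplex w} → Equiv.Perm (Fin 3)} (h : ∀ w, ¬ p w → ρ w = ρ' w)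
    (c : {w : InfinitePlace L // IsComplex w} → Fin 3 → ℝ) :
    chartOrbG L α ν' S' a' (slotPerm ρ c) = chartOrbG L α ν' S' a' (slotPerm ρ' c) := by
  -- change the relabelling one place of the block at a time
  suffices key : ∀ T : Finset {w : InfinitePlace L // IsComplex w}, (∀ w ∈ T, p w) →
      chartOrbG L α ν' S' a' (slotPerm ρ c) = chartOrbG L α ν' S' a' (slotPerm (fun w => if w ∈ T then ρ' w else ρ w) c) by
    have hT := key (Finset.univ.filter p) (fun w hw => (Finset.mem_filter.1 hw).2)
    rw [hT]
    congr 1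
    funext w i
    simp only [slotPerm_apply, Finset.mem_filter, Finset.mem_univ, true_and]
    by_cases hw : p w
    · rw [if_pos hw]
    · rw [if_neg hw, h w hw]
  intro T
  induction T using Finset.induction_on with
  | empty => intro _; simp
  | insert w T hwT ih =>
      intro hT
      have hpw : p w := hT w (Finset.mem_insert_self w T)
      rw [ih fun w' hw' => hT w' (Finset.mem_insert_of_mem hw')]
      -- at `w`: `ρ′ w = ρ w · ((ρ w)⁻¹ ρ′ w)`
      set c₁ : {w : InfinitePlace L // IsComplex w} → Fin 3 → ℝ := slotPerm (fun w' => if w' ∈ T then ρ' w' else ρ w') c with hc₁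
      have hupd : slotPerm (fun w' => if w' ∈ insert w T then ρ' w' else ρ w') c = Function.update c₁ w (c₁ w ∘ ⇑((ρ w)⁻¹ * ρ' w)) := by
        funext w' i
        by_cases hw' : w' = w
        · subst hw'
          have h1 : (ρ w') (((ρ w')⁻¹ * ρ' w') i) = ρ' w' i := by
            rw [Equiv.Perm.mul_apply]
            exact (ρ w').apply_symm_apply _
          simp only [Function.update_self, slotPerm_apply, Finset.mem_insert_self, if_true, hc₁, Function.comp_apply, hwT, if_false, h1]
        · have h2 : ¬ (w' = w ∨ w' ∈ T) ↔ ¬ (w' ∈ T) := by simp [hw']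
          simp only [Function.update_of_ne hw', slotPerm_apply, hc₁, Finset.mem_insert, hw', false_or]
      rw [hupd, chartOrbG_update_comp_perm_of_not_mem_splitChartPlaces L α ν' S' hα hherm hS' (hp w hpw) a' _ c₁]

/-! ## §3 The partner sum over the definite block collapses to `6^{#D}` equal terms -/

omit [NumberField L] [IsCMField L] in
/-- The `p`-block of an admissible label is EMPTY when `p`-places are never chart places: `S′|_p = ∅`. [cite: Rogawski1990, §3.6 p. 28] -/
theorem subtype_eq_empty_of_forall_not_mem {S' : Finset {w : InfinitePlace L // IsComplex w}} (hpS : ∀ w, p w → w ∉ S') : S'.subtype p = ∅ := by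
  ext w
  simp only [Finset.mem_subtype, Finset.notMem_empty, iff_false]
  exact hpS w.1 w.2

/-- `partnerPerms ∅ = univ` (every place compact ⇒ every slot permutation allowed) and its cardinal is `6^{#places}`. [cite: Shelstad1979, Lemma 4.2 p. 23] -/
theorem card_partnerPerms_empty {V : Type*} [Fintype V] [DecidableEq V] : (partnerPerms (∅ : Finset V)).card = 6 ^ Fintype.card V := by
  have h : partnerPerms (∅ : Finset V) = Finset.univ := by
    ext ρ
    simp only [mem_partnerPerms_iff, Finset.notMem_empty, false_implies, implies_true, Finset.mem_univ]
  rw [h, Finset.card_univ, Fintype.card_pi, Finset.prod_const, Finset.card_univ, Fintype.card_perm, Fintype.card_fin]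
  rfl

/-- **THE `α`-SIDE PARTNER SUM OVER THE DEFINITE BLOCK IS `6^{#D}` EQUAL TERMS**: for an admissible `S′` and a block `p` of `α`-definite places,
`Σ_{ρ ∈ partnerPerms S′} chartOrbG ν′ S′ a′ (ρ·c) = 6^{#p} · Σ_{ρ₂ ∈ partnerPerms S′|_{¬p}} chartOrbG ν′ S′ a′ ((1 ⊔ ρ₂)·c)` (★ FILE P (P1) + §2). [cite: Rogawski1990, §4.1 (4.1.1) p. 39; §3.6 p. 28]
[cite: Shelstad1979, Lemma 4.2 p. 23] -/
theorem sum_partnerPerms_chartOrbG_eq_card_mul_sum_restrict (hα : ∀ i, α i ≠ 0) (hherm : ∀ i, (IsCMField.complexConj L (α i) : L) = α i)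
    (hS' : ∀ w, w ∈ S' → w ∈ splitChartPlaces L α) (hp : ∀ w, p w → w ∉ splitChartPlaces L α)
    (a' : ↥(arch (↥(maximalRealSubfield L)) L (IsCMField.complexConj L) 3 (Matrix.diagonal α)) → ℂ) (c : {w : InfinitePlace L // IsComplex w} → Fin 3 → ℝ) :
    ∑ ρ ∈ partnerPerms S', chartOrbG L α ν' S' a' (slotPerm ρ c) =
      (6 : ℂ) ^ Fintype.card {w : {w : InfinitePlace L // IsComplex w} // p w} *
        ∑ ρ₂ ∈ partnerPerms (S'.subtype fun w => ¬ p w),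
          chartOrbG L α ν' S' a' (slotPerm ((Equiv.piEquivPiSubtypeProd p (fun _ => Equiv.Perm (Fin 3))).symm (1, ρ₂)) c) := by
  have hpS : ∀ w, p w → w ∉ S' := fun w hw h => hp w hw (hS' w h)
  rw [sum_partnerPerms_eq_sum_sum_restrict p S']
  -- the inner terms do not depend on the `p`-block relabelling
  have hconst : ∀ ρ₁ ∈ partnerPerms (S'.subtype p), ∀ ρ₂ ∈ partnerPerms (S'.subtype fun w => ¬ p w),
      chartOrbG L α ν' S' a' (slotPerm ((Equiv.piEquivPiSubtypeProd p (fun _ => Equiv.Perm (Fin 3))).symm (ρ₁, ρ₂)) c) =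
        chartOrbG L α ν' S' a' (slotPerm ((Equiv.piEquivPiSubtypeProd p (fun _ => Equiv.Perm (Fin 3))).symm (1, ρ₂)) c) := by
    intro ρ₁ _ ρ₂ _
    refine chartOrbG_slotPerm_eq_of_forall_not_eq L α ν' S' p hα hherm hS' hp a' (fun w hw => ?_) c
    rw [Equiv.piEquivPiSubtypeProd_symm_apply, Equiv.piEquivPiSubtypeProd_symm_apply, dif_neg hw, dif_neg hw]
  rw [Finset.sum_congr rfl fun ρ₁ hρ₁ => Finset.sum_congr rfl fun ρ₂ hρ₂ => hconst ρ₁ hρ₁ ρ₂ hρ₂, Finset.sum_const, nsmul_eq_mul,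
    subtype_eq_empty_of_forall_not_mem L p hpS, card_partnerPerms_empty]
  push_cast
  rfl

end Definite

end Literature.NumberTheory.Rogawski1990

end
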